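import Literature.AnabelianGeometry.AbsoluteAnabelian.AbsTopIII.KummerTowerLaws
import Literature.AnabelianGeometry.AbsoluteAnabelian.AbsTopIII.KummerCurveLawsAPI
import HarnessLib

/-!
# [AbsTopIII] §1: base-change legs — derived API (pull-back of regular units along `Z ×_{k_Z} k′ → Z`,
# Kummer naturality in bundled form)

Mochizuki, *Topics in Absolute Anabelian Geometry III*, §1, Prop. 1.6 p. 34 ("the associated Kummer
map"), Thm. 1.9 (d) pp. 37–38 (lit key `paper:url-5493eb38cbb7`).  Companion of `KummerTowerLaws.lean`
(abc-iut-L4-t1, successor structure `TowerKummerModel`): the DERIVED data a consumer of a base-change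
leg `Z′ → Z` binds (abc-iut-w5-d213's bridge `NFTower.ofCurveLaws`, request 2026-08-26 04:41Z) —

* `bcUnits h` — pull-back of units `K_Z^× → K_{Z′}^×`, injective; `bcUnits_mem_regularUnits` — regular
  units pull back to regular units (unramified law `ord_bcPt`);
* `bcUnitRes h : Additive Γ(Z, 𝒪^×) →+ Additive Γ(Z′, 𝒪^×)` — the `res` datum of the per-system view
  `NFTower` for a base-change leg, injective;
* `kummerAddHom_bcUnitRes` — the law `kummer_bc` in `bcUnitRes` form: `κ_{U′}(f ∘ bc)` pushed along
  `M_{X′} ⥲ M_X` is `κ_U(f)` pulled back along `Π_{U′} → Π_U`.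

HONEST FRAMING: consequences of interface laws; nothing here bears on [IUTchIII] Cor. 3.12.
-/

noncomputable section

open CategoryTheory
open scoped Classical Pointwise

namespace Literature.AnabelianGeometry.AbsoluteAnabelian.AbsTopIII

universe u

namespace TowerKummerModel

variable (M : TowerKummerModel.{u})

/-- Pull-back of units along a base-change leg: `K_Z^× → K_{Z′}^×`, `f ↦ f ∘ (Z′ → Z)`.
[cite: MochizukiAbsTopIII2015, Thm 1.9 (d) p.37] -/
def bcUnits {Z' Z : M.Curve} (h : M.IsBaseChangeOf Z' Z) :
    (M.FunctionField Z)ˣ →* (M.FunctionField Z')ˣ :=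
  Units.map (M.bcField h).toMonoidHom

/-- Formula for `bcUnits` on values. [cite: MochizukiAbsTopIII2015, Thm 1.9 (d) p.37] -/
@[simp] theorem coe_bcUnits {Z' Z : M.Curve} (h : M.IsBaseChangeOf Z' Z) (f : (M.FunctionField Z)ˣ) :
    ((M.bcUnits h f : (M.FunctionField Z')ˣ) : M.FunctionField Z') = M.bcField h f :=
  rfl

/-- `bcUnits` is injective (`K_Z ↪ K_{Z′}` is a homomorphism of fields).
[cite: MochizukiAbsTopIII2015, Thm 1.9 (d) p.37] -/
theorem bcUnits_injective {Z' Z : M.Curve} (h : M.IsBaseChangeOf Z' Z) :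
    Function.Injective (M.bcUnits h) := by
  intro f g hfg
  ext
  exact (M.bcField h).injective
    (by simpa using congrArg (fun u : (M.FunctionField Z')ˣ => (u : M.FunctionField Z')) hfg)

/-- Regular units pull back to regular units along a base-change leg (`ord_{x′}(f ∘ bc) = ord_x(f) = 0`,
law `ord_bcPt`). [cite: MochizukiAbsTopIII2015, Thm 1.9 (d) p.37] -/
theorem bcUnits_mem_regularUnits {Z' Z : M.Curve} (h : M.IsBaseChangeOf Z' Z)
    {f : (M.FunctionField Z)ˣ} (hf : f ∈ M.regularUnits Z) : M.bcUnits h f ∈ M.regularUnits Z' := by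
  intro x'
  rw [bcUnits, M.ord_bcPt h x' f]
  exact hf (M.bcPt h x')

/-- **Pull-back of regular units `Γ(Z, 𝒪^×) → Γ(Z′, 𝒪^×)`** along a base-change leg, written additively
(the `res` datum of the per-system view `NFTower` for base-change legs).
[cite: MochizukiAbsTopIII2015, Thm 1.9 (d) p.37] -/
def bcUnitRes {Z' Z : M.Curve} (h : M.IsBaseChangeOf Z' Z) :
    Additive (M.regularUnits Z) →+ Additive (M.regularUnits Z') :=
  MonoidHom.toAdditive
    { toFun := fun f => ⟨M.bcUnits h f, M.bcUnits_mem_regularUnits h f.2⟩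
      map_one' := Subtype.ext (map_one _)
      map_mul' := fun _ _ => Subtype.ext (map_mul _ _ _) }

/-- Formula for `bcUnitRes`. [cite: MochizukiAbsTopIII2015, Thm 1.9 (d) p.37] -/
@[simp] theorem coe_bcUnitRes {Z' Z : M.Curve} (h : M.IsBaseChangeOf Z' Z) (f : M.regularUnits Z) :
    ((Additive.toMul (M.bcUnitRes h (Additive.ofMul f)) : M.regularUnits Z') : (M.FunctionField Z')ˣ) =
      M.bcUnits h f :=
  rfl

/-- Pull-back of regular units is injective (`NFTower.res_injective` for base-change legs).
[cite: MochizukiAbsTopIII2015, Thm 1.9 (d) p.37] -/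
theorem bcUnitRes_injective {Z' Z : M.Curve} (h : M.IsBaseChangeOf Z' Z) :
    Function.Injective (M.bcUnitRes h) := by
  intro a b hab
  have h1 : M.bcUnits h ((Additive.toMul a : M.regularUnits Z) : (M.FunctionField Z)ˣ) =
      M.bcUnits h ((Additive.toMul b : M.regularUnits Z) : (M.FunctionField Z)ˣ) :=
    congrArg
      (fun z : Additive (M.regularUnits Z') =>
        ((Additive.toMul z : M.regularUnits Z') : (M.FunctionField Z')ˣ)) hab
  exact Additive.toMul.injective (Subtype.ext (M.bcUnits_injective h h1))

/-- **Kummer naturality under base change, `bcUnitRes` form** (law `kummer_bc`): for cofinite opens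
`U ⊆ X`, `U′ ⊆ X′` (`X`, `X′` proper) and base-change legs `U′ → U`, `X′ → X`, and a regular unit `f` of
`U`: `Push_{M_{X′} → M_X}(κ_{U′}(f ∘ bc)) = Pull_{Π_{U′} → Π_U}(κ_U(f))` in `H¹(Π_{U′}, M_X)`.
[cite: MochizukiAbsTopIII2015, Thm 1.9 (d) p.38] -/
theorem kummerAddHom_bcUnitRes {U U' X X' : M.Curve} (hU : M.IsBaseChangeOf U' U)
    (hX : M.IsBaseChangeOf X' X) (h : M.IsCofiniteOpen U X) (h' : M.IsCofiniteOpen U' X')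
    (hXp : M.IsProper X) (hX'p : M.IsProper X') (f : M.regularUnits U) :
    (cyclotomeModH1Push ZHatCoeff.{u} (M.res h') (M.bc hX)).hom
        (M.kummerAddHom h' hX'p (M.bcUnitRes hU (Additive.ofMul f))) =
      (cyclotomeModH1Pull ZHatCoeff.{u} (M.bc hU) (M.res h) (M.res h' ≫ M.bc hX)
          (M.bc_res_comm hU hX h h')).hom
        (M.kummerAddHom h hXp (Additive.ofMul f)) :=
  M.kummer_bc hU hX h h' hXp hX'p f (M.bcUnits_mem_regularUnits hU f.2)

/-- Properness of `X′` from properness of `X` along a base change (law `isProper_bc`), for use with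
`kummerAddHom_bcUnitRes`. [cite: MochizukiAbsTopIII2015, Thm 1.9 (d) p.37] -/
theorem isProper_of_bc {X' X : M.Curve} (hX : M.IsBaseChangeOf X' X) (hXp : M.IsProper X) :
    M.IsProper X' :=
  (M.isProper_bc hX).2 hXp

/-- The base field of a base change embeds the original base field compatibly with `k̄`:
`bcEmb h (bcBase h c) = c` in `k̄_Z`. [cite: MochizukiAbsTopIII2015, Thm 1.9 (d) p.37] -/
theorem bcEmb_bcBase {Z' Z : M.Curve} (h : M.IsBaseChangeOf Z' Z) (c : M.base Z) :
    M.bcEmb h (M.bcBase h c) = algebraMap (M.base Z) (AlgebraicClosure (M.base Z)) c := by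
  rw [← RingHom.comp_apply, M.bcEmb_comp_bcBase h]

/-- Coherence of `k̄`-embeddings along a tower `Z″ → Z′ → Z`, pointwise.
[cite: MochizukiAbsTopIII2015, Thm 1.9 (d) p.37] -/
theorem bcEmb_bcBase' {Z'' Z' Z : M.Curve} (h₁ : M.IsBaseChangeOf Z'' Z') (h₂ : M.IsBaseChangeOf Z' Z)
    (c' : M.base Z') :
    M.bcEmb (M.isBaseChangeOf_trans h₁ h₂) (M.bcBase h₁ c') = M.bcEmb h₂ c' := by
  rw [← RingHom.comp_apply, M.bcEmb_comp_bcBase' h₁ h₂]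

end TowerKummerModel

end Literature.AnabelianGeometry.AbsoluteAnabelian.AbsTopIII
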